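import Literature.Probability.LatticeModels.RandomCluster
import Literature.Probability.Percolation.Percolation
import HarnessLib

/-!
# Connectivity correlation inequalities for `φ_{w,q}`, every `q > 0` — file 20 (DEFINITION): the ANTIPODAL functionals of a finite
# edge set (complementary pairs of configurations)

Definitions file (`--supports stmt-CriticalPhenomena-4575`), FK sub-lane `prim-bschramm-fk-2` (gen 11) of the post-continuity
programme; builds on p205010 (kernel theorem, internal audit signed; external expert review pending).  No named facts, no sorries,
nothing probabilistic: three weight-free finite sums attached to an edge set `E : Finset (Sym2 V)`.

For a configuration `γ ⊆ E` write `γᶜ = E \ γ` for its complement INSIDE `E` and `k(·) = clusterCount · ∅` for the number of open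
clusters counted on all of `V` (Grimmett 2006, (1.20)).  The ANTIPODAL WEIGHT of `γ` is `q^{k(γ) + k(γᶜ)}`: up to the constant factor
`∏_{e ∈ E} p_e (1 - p_e)` it is the probability that two INDEPENDENT samples `ω, ω'` of the random-cluster measure `φ_{E,p,q}` form the
complementary pair `(ω, ω') = (γ, γᶜ)` — for EVERY choice of the edge parameters `p ∈ (0,1)^E`, which therefore drop out.  Sums against
this weight are exactly the COEFFICIENTS of random-cluster covariances viewed as polynomials in the edge odds `z_e = p_e/(1-p_e)`:
`Z_E(z)² · Cov_{φ_{z,q}}(f, g) = ∑_{C ⊔ M ⊆ E} z^{2·1_C + 1_M} · ½ ∑_{γ ⊆ M} q^{k(C ∪ γ) + k(C ∪ (M \ γ))} F(γ) G(γ)` with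
`F(γ) = f(C ∪ γ) - f(C ∪ (M \ γ))` (group the double sum over `(ω, ω')` by `C = ω ∩ ω'`, `M = ω ∆ ω'`); the square-free coefficients
(`C = ∅`) are the antipodal forms below of the sub-networks `M ⊆ E`.
* `FK.apExp E γ = k(γ) + k(E \ γ)` — the antipodal cluster exponent.
* `FK.apConn γ s t ∈ {0, 1}` — the indicator (as a real number) that `s ↔ t` in the open graph of `γ`.
* `FK.apUpc q E s t h = ∑_{γ ⊆ E} q^{k(γ)+k(γᶜ)} · (1{s ↔ t in γ} - 1{s ↔ t in γᶜ}) · h(γ)` — the antipodal UP-CORRELATION functional of a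
  two-terminal network `(E; s, t)` against a test function `h`; by the symmetry `γ ↦ γᶜ` it equals
  `∑_{γ : s ↔ t in γ, s ↮ t in γᶜ} q^{k(γ)+k(γᶜ)} (h(γ) - h(γᶜ))`.
* `FK.apPsi q E f g = ∑_{γ ⊆ E} q^{k(γ)+k(γᶜ)} (f(γ) - f(γᶜ)) (g(γ) - g(γᶜ))` — the antipodal COVARIANCE FORM of two test functions
  (for increasing `f, g` reading disjoint edge sets: twice the square-free top coefficient of `Z² Cov(f, g)`, see above).
The sibling `…AntipodalUpc.lean` proves `0 ≤ apUpc` on every two-terminal series–parallel network for every `q > 0` and every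
monotone `h`, and `…AntipodalNegDep.lean` derives `apPsi ≤ 0` (`0 < q ≤ 1`) for `f` the indicator of one or two edges.
[cite: Grimmett2006, §1.4 eq. (1.20) (p. 15); §3.8 (pp. 61–62)] [cite: Wagner2006, Thm. 5.8(d), §5.3]
-/

noncomputable section

namespace Summit.CriticalPhenomena.PercolationContinuityZ3.Theorems

namespace FK

open Literature.Probability.LatticeModels Literature.Probability.Percolation
open scoped Classical

variable {V : Type*}

/-- **Antipodal cluster exponent** `apExp E γ = k(γ) + k(E \ γ)`: the total number of open clusters (counted on all of `V`, free
boundary) of the configuration `γ` and of its complement inside the edge set `E` (Grimmett 2006, (1.20) for `k`).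
[cite: Grimmett2006, §1.4 eq. (1.20) (p. 15)] -/
def apExp (E γ : Finset (Sym2 V)) : ℕ :=
  clusterCount (↑γ : BondConfig V) ∅ + clusterCount (↑(E \ γ) : BondConfig V) ∅

/-- **Terminal connection indicator** `apConn γ s t = 1{s ↔ t in the open graph of γ}` as a real number. [folklore] -/
def apConn (γ : Finset (Sym2 V)) (s t : V) : ℝ :=
  if (openGraph (↑γ : BondConfig V)).Reachable s t then 1 else 0

/-- **Antipodal up-correlation functional** of the two-terminal network `(E; s, t)` at cluster weight `q` against the test function
`h`: `apUpc q E s t h = ∑_{γ ⊆ E} q^{k(γ)+k(E\γ)} · (1{s ↔ t in γ} - 1{s ↔ t in E \ γ}) · h(γ)`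
(`= ∑_{γ : s↔t in γ, s↮t in E\γ} q^{k(γ)+k(E\γ)} (h(γ) - h(E \ γ))` by the symmetry `γ ↦ E \ γ`).
[cite: Grimmett2006, §1.4 eq. (1.20) (p. 15); §3.8 (pp. 61–62)] -/
def apUpc (q : ℝ) (E : Finset (Sym2 V)) (s t : V) (h : Finset (Sym2 V) → ℝ) : ℝ :=
  ∑ γ ∈ E.powerset, q ^ apExp E γ * ((apConn γ s t - apConn (E \ γ) s t) * h γ)

/-- **Antipodal covariance form** of two test functions on the configurations of `E` at cluster weight `q`:
`apPsi q E f g = ∑_{γ ⊆ E} q^{k(γ)+k(E\γ)} (f(γ) - f(E\γ)) (g(γ) - g(E\γ))` — for increasing `f, g` reading disjoint edge sets,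
twice the coefficient of the square-free monomial `∏_{e∈E} z_e` in `Z_E(z)² Cov_{φ_{z,q}}(f, g)` (edge odds `z`).
[cite: Grimmett2006, §1.4 eq. (1.20) (p. 15); §3.8 (pp. 61–62)] [cite: Wagner2006, Thm. 5.8(d), §5.3] -/
def apPsi (q : ℝ) (E : Finset (Sym2 V)) (f g : Finset (Sym2 V) → ℝ) : ℝ :=
  ∑ γ ∈ E.powerset, q ^ apExp E γ * ((f γ - f (E \ γ)) * (g γ - g (E \ γ)))

end FK

end Summit.CriticalPhenomena.PercolationContinuityZ3.Theorems

end
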